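import Literature.Probability.Percolation.QuadSubquadThickeningHalves
import HarnessLib

/-!
# A thin band around a crossing arc of the square is a crossed sub-quad

Topic `Probability/Percolation`; third plumbing file for the sub-quad thickening lemma
(`QuadSubquadThickening.lean`), in the model square `S = [-1,1]²`.  Let `α ⊆ S` be a simple arc
from `a` (`re a = -1`) to `b` (`re b = 1`) meeting the lines `re = ∓1` only at `a`, `b`, and let
`U ⊇ α` be open.  `exists_band_quad`: **there is a quad `Q ∈ 𝒬_ℂ` with `[Q] ⊆ S ∩ U`, left side
on `re = -1` through `a`, right side on `re = 1` through `b`, containing `α`** — so that `α` is a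
crossing of `Q`.

Construction.  Take the two closed Jordan domains `[Q⁺]` (above) and `[Q⁻]` (below `α`) of
`exists_halves` (`QuadSubquadThickeningHalves.lean`), glued along `α = Q⁺(·, 0) = Q⁻(·, 1)`.  For
`η > 0` below the uniform-continuity modulus of `Q⁺`, `Q⁻` attached to `dist(α, Uᶜ)`, the band is
`Q(x, t) = Q⁺(x, y)` for `0 ≤ y ≤ f(x)` and `Q⁻(x, 1 + y)` for `-g(x) ≤ y ≤ 0`, where
`y = t (f(x) + g(x)) - g(x)` and `f(x) = min(η, dist((x,0), E⁺)/2)` with `E⁺` the closed set of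
parameters that `Q⁺` sends to height `im = 1` (together with the top edge of the parameter square),
and `g` symmetrically with height `-1`: `f` vanishes exactly where `α` touches the top side of `S`,
`g` where it touches the bottom side, never both; a parameter segment `{x} × [0, y]`,
`y ≤ f(x)`, misses `E⁺`, so its connected `Q⁺`-image starts on `α` below height `1` and never
reaches height `1`, hence stays in `S` (as `[Q⁺] ⊆ {-1 ≤ re ≤ 1, -1 ≤ im}`); injectivity of the
glued map comes from `[Q⁺] ∩ [Q⁻] ⊆ α`.  Everything is proved; no named fact is introduced.

## References

* O. Schramm, S. Smirnov, *On the scaling limits of planar percolation*, Ann. Probab. 39 (2011),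
  §1.3 (quads and their crossings). [SchrammSmirnov2011]
-/

noncomputable section

open scoped unitInterval
open Set Metric Function
open Literature.Topology.PlaneTopology

namespace Literature.Probability.Percolation

namespace QuadCrossing

/-! ### Small real-variable helpers -/

/-- Vertical distances in the parameter square. [folklore] -/
theorem dist_mk_same_fst (x s t : I) : dist ((x, s) : I × I) (x, t) = |(s : ℝ) - t| := by
  rw [Prod.dist_eq, dist_self, Subtype.dist_eq, Real.dist_eq, max_eq_right (abs_nonneg _)]

/-- A continuous function avoiding the value `c` on `[0, T]` and below `c` at `0` is below `c` at
`T`. [folklore] -/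
theorem lt_of_forall_ne_of_lt {φ : ℝ → ℝ} {T c : ℝ} (hT : 0 ≤ T) (hφ : ContinuousOn φ (Icc 0 T))
    (hne : ∀ s ∈ Icc 0 T, φ s ≠ c) (h0 : φ 0 < c) : φ T < c := by
  by_contra h
  obtain ⟨s, hs, hφs⟩ := intermediate_value_Icc hT hφ ⟨h0.le, not_lt.1 h⟩
  exact hne s hs hφs

/-- A continuous function avoiding the value `c` on `[0, T]` and above `c` at `0` is above `c` at
`T`. [folklore] -/
theorem lt_of_forall_ne_of_lt' {φ : ℝ → ℝ} {T c : ℝ} (hT : 0 ≤ T) (hφ : ContinuousOn φ (Icc 0 T))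
    (hne : ∀ s ∈ Icc 0 T, φ s ≠ c) (h0 : c < φ 0) : c < φ T := by
  by_contra h
  obtain ⟨s, hs, hφs⟩ := intermediate_value_Icc' hT hφ ⟨not_lt.1 h, h0.le⟩
  exact hne s hs hφs

/-! ### The band -/

/-- **A thin band around a crossing arc of the square is a crossed sub-quad.**  Let
`α ⊆ S = [-1,1]²` be a simple arc from `a` (`re a = -1`) to `b` (`re b = 1`) meeting the lines
`re = ∓1` only at `a`, `b`, and `U ⊇ α` open.  Then some quad `Q ∈ 𝒬_ℂ` has `[Q] ⊆ S ∩ U`,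
`∂₀Q ⊆ {re = -1}`, `∂₂Q ⊆ {re = 1}`, `α ⊆ [Q]`, `a ∈ ∂₀Q`, `b ∈ ∂₂Q` (a band cut out of the two
closed Jordan domains above and below `α`, see the module docstring).
[cite: SchrammSmirnov2011, §1.3 (quads and their crossings)] -/
theorem exists_band_quad {α : Set ℂ} {a b : ℂ} (hα : IsSimpleArc α a b)
    (hαS : α ⊆ Icc (-1 : ℝ) 1 ×ℂ Icc (-1 : ℝ) 1) (ha : a.re = -1) (hb : b.re = 1)
    (hαa : ∀ z ∈ α, z.re = -1 → z = a) (hαb : ∀ z ∈ α, z.re = 1 → z = b)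
    {U : Set ℂ} (hU : IsOpen U) (hαU : α ⊆ U) :
    ∃ Q : Quad (univ : Set ℂ), Q.carrier ⊆ (Icc (-1 : ℝ) 1 ×ℂ Icc (-1 : ℝ) 1) ∩ U ∧
      Q.side 0 ⊆ {z | z.re = -1} ∧ Q.side 2 ⊆ {z | z.re = 1} ∧ α ⊆ Q.carrier ∧
      a ∈ Q.side 0 ∧ b ∈ Q.side 2 := by
  obtain ⟨QU, QD, hglue, hreU, hU0, hU2, hD0, hD2, hboxU, hboxD, hsep⟩ :=
    exists_halves hα hαS ha hb hαa hαb
  set eU : I → ℂ := fun x => QU (x, 0) with heU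
  have heUα : ∀ x, eU x ∈ α := fun x => hreU ▸ mem_range_self x
  -- the width `η`
  obtain ⟨ρ, hρ, hρU⟩ := hα.isCompact.exists_thickening_subset_open hU hαU
  obtain ⟨ηU, hηU, hucU⟩ := Metric.uniformContinuous_iff.1
    (CompactSpace.uniformContinuous_of_continuous QU.continuous_toFun) ρ hρ
  obtain ⟨ηD, hηD, hucD⟩ := Metric.uniformContinuous_iff.1
    (CompactSpace.uniformContinuous_of_continuous QD.continuous_toFun) ρ hρ
  set η : ℝ := min (min ηU ηD) 1 / 2 with hη
  have hη0 : 0 < η := by rw [hη]; positivity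
  have hηU' : η < ηU := by
    rw [hη]; linarith [min_le_left (min ηU ηD) 1, min_le_left ηU ηD, lt_min (lt_min hηU hηD) one_pos]
  have hηD' : η < ηD := by
    rw [hη]; linarith [min_le_left (min ηU ηD) 1, min_le_right ηU ηD, lt_min (lt_min hηU hηD) one_pos]
  have hη1 : η ≤ 1 := by rw [hη]; linarith [min_le_right (min ηU ηD) 1]
  -- the closed parameter sets sent to the top and bottom sides
  set EU : Set (I × I) := {p | (QU p).im = 1} ∪ {p | p.2 = 1} with hEU
  set ED : Set (I × I) := {p | (QD p).im = -1} ∪ {p | p.2 = 0} with hED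
  have hEUc : IsClosed EU :=
    (isClosed_eq (Complex.continuous_im.comp QU.continuous_toFun) continuous_const).union
      (isClosed_eq continuous_snd continuous_const)
  have hEDc : IsClosed ED :=
    (isClosed_eq (Complex.continuous_im.comp QD.continuous_toFun) continuous_const).union
      (isClosed_eq continuous_snd continuous_const)
  -- the half-widths `f`, `g`
  set f : I → ℝ := fun x => min η (infDist ((x, 0) : I × I) EU / 2) with hf
  set g : I → ℝ := fun x => min η (infDist ((x, 1) : I × I) ED / 2) with hg
  have hfc : Continuous f := continuous_const.min
    (((continuous_infDist_pt EU).comp (continuous_id.prodMk continuous_const)).div_const 2)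
  have hgc : Continuous g := continuous_const.min
    (((continuous_infDist_pt ED).comp (continuous_id.prodMk continuous_const)).div_const 2)
  have hf0 : ∀ x, 0 ≤ f x := fun x => le_min hη0.le (div_nonneg infDist_nonneg (by norm_num))
  have hg0 : ∀ x, 0 ≤ g x := fun x => le_min hη0.le (div_nonneg infDist_nonneg (by norm_num))
  have hfη : ∀ x, f x ≤ η := fun x => min_le_left _ _
  have hgη : ∀ x, g x ≤ η := fun x => min_le_left _ _
  have hfd : ∀ x, f x ≤ infDist ((x, 0) : I × I) EU / 2 := fun x => min_le_right _ _
  have hgd : ∀ x, g x ≤ infDist ((x, 1) : I × I) ED / 2 := fun x => min_le_right _ _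
  have hf_zero : ∀ x, f x = 0 → (eU x).im = 1 := fun x hx => by
    have h1 : infDist ((x, 0) : I × I) EU = 0 := by
      rcases min_eq_iff.1 hx with ⟨h, -⟩ | ⟨h, -⟩
      · exact absurd h hη0.ne'
      · linarith
    have h2 := (hEUc.mem_iff_infDist_zero ⟨(x, 1), Or.inr rfl⟩).2 h1
    rcases h2 with h | h
    · exact h
    · exact absurd h (by simp)
  have hg_zero : ∀ x, g x = 0 → (eU x).im = -1 := fun x hx => by
    have h1 : infDist ((x, 1) : I × I) ED = 0 := by
      rcases min_eq_iff.1 hx with ⟨h, -⟩ | ⟨h, -⟩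
      · exact absurd h hη0.ne'
      · linarith
    have h2 := (hEDc.mem_iff_infDist_zero ⟨(x, 0), Or.inr rfl⟩).2 h1
    rcases h2 with h | h
    · rw [heU]; dsimp only; rw [hglue]; exact h
    · exact absurd h (by simp)
  have hF : ∀ x, 0 < f x + g x := fun x => by
    by_contra h
    have h1 : f x = 0 := le_antisymm (by linarith [hg0 x]) (hf0 x)
    have h2 : g x = 0 := le_antisymm (by linarith [hf0 x]) (hg0 x)
    have := hf_zero x h1
    have := hg_zero x h2
    linarith
  -- the height `y` and the glued map
  set y : I × I → ℝ := fun p => (p.2 : ℝ) * (f p.1 + g p.1) - g p.1 with hy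
  have hyc : Continuous y :=
    ((continuous_subtype_val.comp continuous_snd).mul
      ((hfc.comp continuous_fst).add (hgc.comp continuous_fst))).sub (hgc.comp continuous_fst)
  have hyf : ∀ p, y p ≤ f p.1 := fun p => by
    have h1 : (p.2 : ℝ) ≤ 1 := p.2.2.2
    have := mul_le_mul_of_nonneg_right h1 (hF p.1).le
    show (p.2 : ℝ) * (f p.1 + g p.1) - g p.1 ≤ f p.1
    linarith
  have hyg : ∀ p, -g p.1 ≤ y p := fun p => by
    have h1 : (0 : ℝ) ≤ p.2 := p.2.2.1
    have := mul_nonneg h1 (hF p.1).le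
    show -g p.1 ≤ (p.2 : ℝ) * (f p.1 + g p.1) - g p.1
    linarith
  set pr : ℝ → I := projIcc (0 : ℝ) 1 zero_le_one with hpr
  have hprc : Continuous pr := continuous_projIcc
  have hpr_val : ∀ {s : ℝ}, 0 ≤ s → s ≤ 1 → ((pr s : I) : ℝ) = s := fun h0 h1 => by
    rw [hpr, projIcc_of_mem _ ⟨h0, h1⟩]
  have hpr0 : pr 0 = 0 := by rw [hpr, projIcc_left]; rfl
  have hpr1 : pr 1 = 1 := by rw [hpr, projIcc_right]; rfl
  set P : I × I → ℂ := fun p => if y p ≤ 0 then QD (p.1, pr (1 + y p)) else QU (p.1, pr (y p))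
    with hP
  have hPD : ∀ p, y p ≤ 0 → P p = QD (p.1, pr (1 + y p)) := fun p hp => if_pos hp
  have hPU : ∀ p, 0 ≤ y p → P p = QU (p.1, pr (y p)) := fun p hp => by
    by_cases h : y p ≤ 0
    · have h0 : y p = 0 := le_antisymm h hp
      rw [hPD p h, h0, add_zero, hpr1, hpr0, ← hglue]
    · exact if_neg h
  have hPc : Continuous P := by
    refine Continuous.if_le ?_ ?_ hyc continuous_const fun p hp => ?_
    · exact QD.continuous_toFun.comp (continuous_fst.prodMk (hprc.comp (continuous_const.add hyc)))
    · exact QU.continuous_toFun.comp (continuous_fst.prodMk (hprc.comp hyc))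
    · rw [hp, add_zero, hpr1, hpr0, ← hglue]
  -- distances to `α` and membership in `U`
  have hPUα : ∀ p, 0 ≤ y p → dist (P p) (eU p.1) < ρ := fun p hp => by
    rw [hPU p hp]
    refine hucU ?_
    rw [dist_mk_same_fst, hpr_val hp ((hyf p).trans ((hfη _).trans hη1))]
    simp only [Icc.coe_zero, sub_zero]
    rw [abs_of_nonneg hp]
    linarith [hyf p, hfη p.1]
  have hPDα : ∀ p, y p ≤ 0 → dist (P p) (eU p.1) < ρ := fun p hp => by
    rw [hPD p hp, heU]
    dsimp only
    rw [hglue]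
    refine hucD ?_
    have h1 : 0 ≤ 1 + y p := by linarith [hyg p, hgη p.1]
    rw [dist_mk_same_fst, hpr_val h1 (by linarith)]
    simp only [Icc.coe_one, add_sub_cancel_left]
    rw [abs_of_nonpos hp]
    linarith [hyg p, hgη p.1]
  have hPUmem : ∀ p, P p ∈ U := fun p => by
    refine hρU (mem_thickening_iff.2 ⟨eU p.1, heUα p.1, ?_⟩)
    rcases le_total 0 (y p) with h | h
    · exact hPUα p h
    · exact hPDα p h
  -- the band lies in the square
  have hPS : ∀ p, P p ∈ Icc (-1 : ℝ) 1 ×ℂ Icc (-1 : ℝ) 1 := fun p => by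
    rcases le_total 0 (y p) with h | h
    · -- upper half: the vertical parameter segment misses `EU`
      rw [hPU p h]
      obtain ⟨h1, h2, h3⟩ := hboxU ⟨(p.1, pr (y p)), rfl⟩
      refine ⟨⟨h1, h2⟩, h3, ?_⟩
      rcases (hf0 p.1).eq_or_lt with h0 | h0
      · have hy0 : y p = 0 := le_antisymm (h0 ▸ hyf p) h
        rw [hy0, hpr0]
        exact (hαS (heUα p.1)).2.2
      · have hd : y p < infDist ((p.1, 0) : I × I) EU := by linarith [hyf p, hfd p.1]
        set ψ : ℝ → ℝ := fun s => (QU (p.1, pr s)).im with hψ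
        have hψc : Continuous ψ := Complex.continuous_im.comp
          (QU.continuous_toFun.comp (continuous_const.prodMk hprc))
        have hne : ∀ s ∈ Icc 0 (y p), ψ s ≠ 1 := fun s hs h1 => by
          have hs1 : s ≤ 1 := hs.2.trans ((hyf p).trans ((hfη _).trans hη1))
          have hmem : ((p.1, pr s) : I × I) ∉ EU := by
            refine notMem_of_dist_lt_infDist (x := ((p.1, 0) : I × I)) ?_
            rw [dist_mk_same_fst, hpr_val hs.1 hs1]
            simp only [Icc.coe_zero, zero_sub, abs_neg]
            rw [abs_of_nonneg hs.1]
            exact hs.2.trans_lt hd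
          exact hmem (Or.inl h1)
        have hψ0 : ψ 0 < 1 := by
          have h0' : ψ 0 ≠ 1 := hne 0 ⟨le_rfl, h⟩
          have : ψ 0 ≤ 1 := by
            show (QU (p.1, pr 0)).im ≤ 1
            rw [hpr0]; exact (hαS (heUα p.1)).2.2
          exact lt_of_le_of_ne this h0'
        exact (lt_of_forall_ne_of_lt h hψc.continuousOn hne hψ0).le
    · rw [hPD p h]
      obtain ⟨h1, h2, h3⟩ := hboxD ⟨(p.1, pr (1 + y p)), rfl⟩
      refine ⟨⟨h1, h2⟩, ?_, h3⟩
      rcases (hg0 p.1).eq_or_lt with h0 | h0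
      · have hy0 : y p = 0 := le_antisymm h (by linarith [h0 ▸ hyg p])
        rw [hy0, add_zero, hpr1, ← hglue]
        exact (hαS (heUα p.1)).2.1
      · have hd : -y p < infDist ((p.1, 1) : I × I) ED := by linarith [hyg p, hgd p.1]
        set ψ : ℝ → ℝ := fun s => (QD (p.1, pr (1 - s))).im with hψ
        have hψc : Continuous ψ := Complex.continuous_im.comp
          (QD.continuous_toFun.comp (continuous_const.prodMk
            (hprc.comp (continuous_const.sub continuous_id))))
        have hne : ∀ s ∈ Icc 0 (-y p), ψ s ≠ -1 := fun s hs h1 => by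
          have hs1 : s ≤ 1 := hs.2.trans (by linarith [hyg p, hgη p.1])
          have hmem : ((p.1, pr (1 - s)) : I × I) ∉ ED := by
            refine notMem_of_dist_lt_infDist (x := ((p.1, 1) : I × I)) ?_
            rw [dist_mk_same_fst, hpr_val (by linarith) (by linarith [hs.1])]
            simp only [Icc.coe_one, sub_sub_cancel]
            rw [abs_of_nonneg hs.1]
            exact hs.2.trans_lt hd
          exact hmem (Or.inl h1)
        have hψ0 : -1 < ψ 0 := by
          have h0' : ψ 0 ≠ -1 := hne 0 ⟨le_rfl, by linarith⟩
          have : -1 ≤ ψ 0 := by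
            show -1 ≤ (QD (p.1, pr (1 - 0))).im
            rw [sub_zero, hpr1, ← hglue]; exact (hαS (heUα p.1)).2.1
          exact lt_of_le_of_ne this (Ne.symm h0')
        have := lt_of_forall_ne_of_lt' (by linarith) hψc.continuousOn hne hψ0
        have e : (1 : ℝ) - -y p = 1 + y p := by ring
        show -1 ≤ (QD (p.1, pr (1 + y p))).im
        rw [← e]; exact this.le
  -- injectivity
  have hyU_inj : ∀ p q, 0 ≤ y p → 0 ≤ y q → QU (p.1, pr (y p)) = QU (q.1, pr (y q)) → p = q := by
    intro p q hp hq h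
    have h1 := QU.injective_toFun h
    simp only [Prod.mk.injEq] at h1
    obtain ⟨h1, h2⟩ := h1
    have h3 : y p = y q := by
      have := congrArg Subtype.val h2
      rwa [hpr_val hp ((hyf p).trans ((hfη _).trans hη1)),
        hpr_val hq ((hyf q).trans ((hfη _).trans hη1))] at this
    refine Prod.ext h1 (Subtype.ext ?_)
    have h4 : (p.2 : ℝ) * (f p.1 + g p.1) = (q.2 : ℝ) * (f p.1 + g p.1) := by
      have := h3; rw [hy] at this; dsimp only at this; rw [← h1] at this; linarith
    exact mul_right_cancel₀ (hF p.1).ne' h4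
  have hyD_inj : ∀ p q, y p ≤ 0 → y q ≤ 0 →
      QD (p.1, pr (1 + y p)) = QD (q.1, pr (1 + y q)) → p = q := by
    intro p q hp hq h
    have h1 := QD.injective_toFun h
    simp only [Prod.mk.injEq] at h1
    obtain ⟨h1, h2⟩ := h1
    have h3 : y p = y q := by
      have := congrArg Subtype.val h2
      rw [hpr_val (by linarith [hyg p, hgη p.1]) (by linarith),
        hpr_val (by linarith [hyg q, hgη q.1]) (by linarith)] at this
      linarith
    refine Prod.ext h1 (Subtype.ext ?_)
    have h4 : (p.2 : ℝ) * (f p.1 + g p.1) = (q.2 : ℝ) * (f p.1 + g p.1) := by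
      have := h3; rw [hy] at this; dsimp only at this; rw [← h1] at this; linarith
    exact mul_right_cancel₀ (hF p.1).ne' h4
  have hmixed : ∀ p q, 0 ≤ y p → y q ≤ 0 → P p = P q → p = q := by
    intro p q hp hq h
    -- the common value lies in `[Q⁺] ∩ [Q⁻] ⊆ α`
    have hvU : P p ∈ QU.carrier := by rw [hPU p hp]; exact ⟨_, rfl⟩
    have hvD : P p ∈ QD.carrier := by rw [h, hPD q hq]; exact ⟨_, rfl⟩
    obtain ⟨x₀, hx₀⟩ : P p ∈ range eU := hreU.symm ▸ hsep ⟨hvU, hvD⟩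
    have hx₀' : QU (x₀, pr 0) = eU x₀ := by rw [hpr0]
    -- so both heights vanish
    have hp0 : y p = 0 ∧ p.1 = x₀ := by
      have e : QU (p.1, pr (y p)) = QU (x₀, pr 0) := by rw [← hPU p hp, hx₀', hx₀]
      have h1 := QU.injective_toFun e
      simp only [Prod.mk.injEq] at h1
      refine ⟨?_, h1.1⟩
      have := congrArg Subtype.val h1.2
      rwa [hpr_val hp ((hyf p).trans ((hfη _).trans hη1)), hpr0] at this
    have hq0 : y q = 0 ∧ q.1 = x₀ := by
      have e : QD (q.1, pr (1 + y q)) = QD (x₀, pr 1) := by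
        rw [← hPD q hq, ← h, ← hx₀, hpr1, ← hglue]
      have h1 := QD.injective_toFun e
      simp only [Prod.mk.injEq] at h1
      refine ⟨?_, h1.1⟩
      have := congrArg Subtype.val h1.2
      rw [hpr_val (by linarith [hyg q, hgη q.1]) (by linarith), hpr1] at this
      simpa using this
    exact hyU_inj p q hp (by rw [hq0.1]) (by rw [hp0.1, hq0.1, hp0.2, hq0.2])
  have hPi : Injective P := fun p q h => by
    rcases le_total 0 (y p) with hp | hp <;> rcases le_total 0 (y q) with hq | hq
    · rw [hPU p hp, hPU q hq] at h; exact hyU_inj p q hp hq h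
    · exact hmixed p q hp hq h
    · exact (hmixed q p hq hp h.symm).symm
    · rw [hPD p hp, hPD q hq] at h; exact hyD_inj p q hp hq h
  -- the quad
  let Q : Quad (univ : Set ℂ) :=
    { toFun := P
      continuous_toFun := hPc
      injective_toFun := hPi
      range_subset := subset_univ _ }
  -- `α ⊆ [Q]`: `eU x = Q(x, g(x)/(f(x)+g(x)))`
  have hαQ : ∀ x, ∃ t : I, y (x, t) = 0 := fun x => by
    refine ⟨⟨g x / (f x + g x), div_nonneg (hg0 x) (hF x).le,
      (div_le_one (hF x)).2 (by linarith [hf0 x])⟩, ?_⟩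
    show g x / (f x + g x) * (f x + g x) - g x = 0
    rw [div_mul_cancel₀ _ (hF x).ne', sub_self]
  have hαQ' : ∀ x, ∃ t : I, Q (x, t) = eU x := fun x => by
    obtain ⟨t, ht⟩ := hαQ x
    refine ⟨t, ?_⟩
    show P (x, t) = eU x
    rw [hPU (x, t) ht.ge, ht, hpr0]
  have heU0 : eU 0 = a := hαa _ (heUα 0) (hU0 (QU.apply_zero_mem_side_zero 0))
  have heU1 : eU 1 = b := hαb _ (heUα 1) (hU2 (QU.apply_one_mem_side_two 0))
  refine ⟨Q, ?_, ?_, ?_, ?_, ?_, ?_⟩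
  · rintro _ ⟨p, rfl⟩
    exact ⟨hPS p, hPUmem p⟩
  · rintro _ ⟨p, hp, rfl⟩
    have hp' : p.1 = 0 := hp
    show (P p).re = -1
    rcases le_total 0 (y p) with h | h
    · rw [hPU p h, hp']; exact hU0 (QU.apply_zero_mem_side_zero _)
    · rw [hPD p h, hp']; exact hD0 (QD.apply_zero_mem_side_zero _)
  · rintro _ ⟨p, hp, rfl⟩
    have hp' : p.1 = 1 := hp
    show (P p).re = 1
    rcases le_total 0 (y p) with h | h
    · rw [hPU p h, hp']; exact hU2 (QU.apply_one_mem_side_two _)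
    · rw [hPD p h, hp']; exact hD2 (QD.apply_one_mem_side_two _)
  · intro z hz
    obtain ⟨x, rfl⟩ : z ∈ range eU := hreU.symm ▸ hz
    obtain ⟨t, ht⟩ := hαQ' x
    exact ⟨(x, t), ht⟩
  · obtain ⟨t, ht⟩ := hαQ' 0
    rw [← heU0, ← ht]
    exact Q.apply_zero_mem_side_zero t
  · obtain ⟨t, ht⟩ := hαQ' 1
    rw [← heU1, ← ht]
    exact Q.apply_one_mem_side_two t

end QuadCrossing

end Literature.Probability.Percolation
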